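import Literature.NumberTheory.ComplexMultiplication.ShimuraTaniyamaOfMainTheoremAbelianScheme
import Literature.NumberTheory.ComplexMultiplication.MainTheoremOfComplexMultiplicationHolds
import Literature.AlgebraicGeometry.Motives.TateAbelianFiniteSteps
import HarnessLib

/-!
# Shimura–Taniyama on the DUAL eigenline: arithmetic Frobenius acts on the `τ`-eigenline of `H¹_ét = V_ℓ(A₀)^∨` of a CM
# abelian variety by the INVERSE uniformiser value `χ_τ(ϖ_v)⁻¹`

Topic `NumberTheory/ComplexMultiplication`; namespace `Literature.NumberTheory.ComplexMultiplication`.  THEOREMS ONLY (no definition,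
no named fact, no instance, no `sorry`); every input is a landed theorem of the tree: the Main Theorem of Complex Multiplication
`shimura1998_thm18_6_holds` ([Shimura1998] Thm. 18.6) and the Shimura–Taniyama family in Serre–Tate currency
`shimuraTaniyama_heckeCharactersST_eventually_of_thm18_6` ([Shimura1998] Prop. 19.10 / Thm. 19.11; [SerreTate1968] §7 Thms. 10–11),
plus the tree's rational Tate module API (`AbelianVariety.rationalTateRep`, `rationalTateModuleMap`, ★ `TateAbelianFiniteSteps`) and
Mathlib's contragredient `Representation.dual`.

## What is proved (and the DICTIONARY LINE for the cell `hodgecm-mathlib`)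

For a structure `(A₀, ι₀ : 𝓞 K →+* End A₀)` of CM type `(K, Φ)` over a number field `k ⊂ ℂ` (`IsCMTypeRealisationOver Φ A₀ ι₀`)
the tree proves: for all `v` outside a finite set there is `π_v ∈ 𝓞 K` with `χ_τ(ϖ_v) = τ(π_v)` for every `τ : K → ℂ` and every
ARITHMETIC Frobenius `σ` at a prime `𝔓 ∣ v` of `k̄` acts on the (covariant) Tate module `T_ℓ A₀` (`ℓ ∤ v`) as `T_ℓ(ι₀ π_v)`.
Here we pass to the CONTRAGREDIENT representation on `H¹ := Hom_{ℚ_ℓ}(V_ℓ A₀, ℚ_ℓ)` (Mathlib `Representation.dual`: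
`σ ↦ ᵗρ(σ⁻¹)`), extend scalars to any field `R ⊇ ℚ_ℓ` (e.g. `ℚ_ℓ^{ac}` along `ι′ : ℂ ≃ ℚ_ℓ^{ac}`), and read the action on an
EIGENLINE of the transposed `𝓞 K`-action with eigencharacter `e : K →+* R`:

  `σ` acts on `{f ∈ R ⊗ H¹ : ∀ x, ᵗV_ℓ(ι₀ x) f = e(x) f}` as the scalar `e(π_v)⁻¹`;  with `e = ι′ ∘ τ`: as `(ι′ (χ_τ(ϖ_v)))⁻¹`.

DICTIONARY LINE (for the d6 card of crux `HLiu418`, stmt-HodgeConjecture-24832, census `CENSUS-D6-CM-road.A-p04g13.md` §4):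
this is EXACTLY the normalisation of the registered residual `thmD6OneCurveCUF` ([Liu2021] Thm. D.6 (1) one curve) — cohomological
`H¹ = V_ℓ^∨` (the tree's `Sec42Data.etaleH1 := Module.Dual ℚ_[ℓ] (V_ℓ A_K)`, `etaleH1Rep := (rationalTateRep).dual`,
`etaleH1Rep_apply`), ARITHMETIC Frobenius (`IsArithFrobAt`), INVERSE uniformiser value (`(ι' (….valueAtUniformizer v))⁻¹ • f'`).
So the CM step of the printed proof of [Liu2021] Thm. D.6 (1) (§D.4, FJcycle.tex l. 5628, «`μ̃` is the associated CM character of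
`B₀`») is available in the consumer's currency with zero adapters: a d6-line (S-CM) stub «the `ω⋆`-values are `τ₀`-eigen-dual-Tate
classes of a CM quotient `B₀` with Shimura–Taniyama character `χ_{τ₀} = μ^{alg}`» closes against `dual_rationalTateRep_eigenline_eventually`
below.  Nothing here is specific to Shimura curves; the file moves no book of the cell (HC_CM is proved only modulo the 7 printed
citations until rung 0 closes).

## Contents
* §1 `Representation.dual_baseChange_eq_inv_smul_of_eigen` — linear algebra: if `ᵗ(ρ g)` has eigenvalue `c ≠ 0` on `f ∈ R ⊗ V^∨`,
  the contragredient `ρ^∨(g) = ᵗρ(g⁻¹)` acts on `f` by `c⁻¹`.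
* §2 `IsCMTypeRealisationOver.rationalTateRep_eq_of_tateRep_eq` (integral ⟹ rational Frobenius identity),
  `IsCMTypeRealisationOver.dual_rationalTateRep_eigenline_eventually` (the head, eigencharacter `e : K →+* R`),
  `IsCMTypeRealisationOver.dual_rationalTateRep_eigenline_eventually_along` (the `ι′ ∘ τ` form with `(ι′ (χ_τ.valueAtUniformizer v))⁻¹`).

## References
* [Shimura1998] G. Shimura, *Abelian Varieties with Complex Multiplication and Modular Functions*, Princeton (1998): Thm. 18.6;
  Prop. 19.10; Thm. 19.11 and its proof («`r(w)^σ = ι(β) r(w)`»).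
* [SerreTate1968] J.-P. Serre, J. Tate, *Good reduction of abelian varieties*, Ann. of Math. 88 (1968): §7 Thm. 10, Thm. 11 and the
  paragraph before it («`ρ_l` … takes the value `π_v`»).
* [Liu2021] Y. Liu, *Fourier–Jacobi cycles and arithmetic relative trace formula*, Camb. J. Math. 9 (2021): §4.3 l. 2152–2165
  (`H¹_ét` of the Albanese tower), App. D Thm. D.6 (1) and its proof §D.4 l. 5628.
* [Milne1986AbelianVarieties] J. S. Milne, *Abelian varieties* (Cornell–Silverman 1986), Thm. 15.1 (a): `H¹_ét = (T_ℓ)^∨`.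
-/

set_option autoImplicit false

noncomputable section

open CategoryTheory IsDedekindDomain NumberField
open scoped TensorProduct NumberField nonZeroDivisors ComplexConjugate

namespace Literature.NumberTheory.ComplexMultiplication

/-! ## §1. Linear algebra: the contragredient on an eigenline of the transpose -/

section LinearAlgebra

variable {k G V : Type*} [CommRing k] [Group G] [AddCommGroup V] [Module k V]

/-- **Contragredient on a transposed eigenline.**  Let `ρ : G → GL(V)` be a representation over `k`, `R` a field over `k`,
`f ∈ R ⊗_k V^∨`.  If the base-changed transpose `1 ⊗ ᵗρ(g)` has `f` as an eigenvector with eigenvalue `c ≠ 0`, then the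
contragredient `ρ^∨(g) = ᵗρ(g⁻¹)` (Mathlib `Representation.dual`), base-changed to `R`, acts on `f` by `c⁻¹`:
`ᵗρ(g⁻¹) ∘ ᵗρ(g) = ᵗ(ρ(g) ρ(g⁻¹)) = 1`. [cite: SerreTate1968, §1 (the contragredient `ℓ`-adic representation)] -/
theorem Representation.dual_baseChange_eq_inv_smul_of_eigen (ρ : Representation k G V) (R : Type*) [Field R] [Algebra k R]
    (g : G) {c : R} (hc : c ≠ 0) (f : R ⊗[k] Module.Dual k V)
    (hf : ((ρ g).dualMap).baseChange R f = c • f) :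
    (ρ.dual g).baseChange R f = c⁻¹ • f := by
  -- `ᵗρ(g⁻¹) ∘ ᵗρ(g) = ᵗ(ρ(g) ∘ ρ(g⁻¹)) = ᵗ(ρ 1) = 1`
  have hcomp : (ρ g⁻¹).dualMap ∘ₗ (ρ g).dualMap = LinearMap.id := by
    rw [LinearMap.dualMap_comp_dualMap]
    have : ρ g ∘ₗ ρ g⁻¹ = LinearMap.id := by
      rw [← Module.End.mul_eq_comp, ← map_mul, mul_inv_cancel, map_one]
      rfl
    rw [this]
    exact LinearMap.dualMap_id
  have hdual : ρ.dual g = (ρ g⁻¹).dualMap := _root_.Representation.dual_apply ρ g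
  -- base change the composite identity and evaluate at `f`
  have hbc : ((ρ g⁻¹).dualMap).baseChange R (((ρ g).dualMap).baseChange R f) = f := by
    have := congrArg (fun (L : Module.Dual k V →ₗ[k] Module.Dual k V) => (L.baseChange R) f) hcomp
    simpa only [LinearMap.baseChange_comp, LinearMap.comp_apply, LinearMap.baseChange_id, LinearMap.id_apply] using this
  rw [hf, map_smul] at hbc
  -- `c • ᵗρ(g⁻¹) f = f` ⟹ `ᵗρ(g⁻¹) f = c⁻¹ • f`
  rw [hdual]
  have := congrArg (fun y => c⁻¹ • y) hbc
  simpa only [smul_smul, inv_mul_cancel₀ hc, one_smul] using this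

end LinearAlgebra

/-! ## §2. The CM eigenline: arithmetic Frobenius acts by the inverse uniformiser value -/

open Literature.AlgebraicGeometry.Motives
open Literature.AlgebraicGeometry.Motives.AbelianVariety (rationalTateModuleMap rationalTateRep_apply)
open Literature.NumberTheory.GaloisRepresentations
variable {k : Type} [Field k] [NumberField k] [Algebra k ℂ] {K : Type} [Field K] [NumberField K]

omit [NumberField k] [Algebra k ℂ] in
/-- From the integral Frobenius identity `ρ_T(σ) = T_ℓ(ι₀ π)` on `T_ℓ A₀` (the Shimura–Taniyama clause (5ST)) to the rational one
`ρ_V(σ) = V_ℓ(ι₀ π)` on `V_ℓ A₀ = ℚ_ℓ ⊗ T_ℓ A₀` (both sides are base changes: `rationalTateRep_apply`, `rationalTateModuleMap`).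
[cite: SerreTate1968, §1 (`V_ℓ = T_ℓ ⊗ ℚ_ℓ`) and §7 (the paragraph before Thm. 11)] -/
theorem rationalTateRep_eq_of_tateRep_eq {A₀ : AbelianVariety k} {ℓ : ℕ} [Fact ℓ.Prime]
    {σ : Field.absoluteGaloisGroup k} {φ : A₀ ⟶ A₀} (h : A₀.tateRep ℓ σ = AbelianVariety.tateModuleMap ℓ φ) :
    A₀.rationalTateRep ℓ σ = rationalTateModuleMap ℓ φ := by
  rw [rationalTateRep_apply, h]

/-- **Shimura–Taniyama on the dual eigenline (head).**  For `(A₀, ι₀)` of CM type `(K, Φ)` over `k ⊂ ℂ` there is the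
Shimura–Taniyama family `χ : (K →+* ℂ) → HeckeCharacter k` (infinity types `cmInfinityType Φ τ`, conjugation, `K`-values on local
idèles — clauses (1)–(3) of `shimuraTaniyama_heckeCharactersST_eventually_of_thm18_6`, repeated) such that for all `v` outside a
FINITE set there is `π ∈ 𝓞 K` with `χ_τ(ϖ_v) = τ(π)` for all `τ`, and for every prime `ℓ` not under `v`, every `𝔓 ∣ v` and every
ARITHMETIC Frobenius `σ` at `𝔓`: (i) `ρ_V(σ) = V_ℓ(ι₀ π)` on `V_ℓ A₀`; (ii) for every field `R ⊇ ℚ_ℓ`, every `e : K →+* R` and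
every `f ∈ R ⊗ (V_ℓ A₀)^∨` on which the transposed `𝓞 K`-action has eigencharacter `e` (`(1 ⊗ ᵗV_ℓ(ι₀ x)) f = e(x) f` for all
`x ∈ 𝓞 K`), the contragredient acts by `(1 ⊗ ρ_V^∨(σ)) f = e(π)⁻¹ • f`.  (`e(π) ≠ 0` because `χ_τ(ϖ_v) ∈ ℂˣ`.)
[cite: Shimura1998, Prop. 19.10, Thm. 19.11 (proof: «`r(w)^σ = ι(β) r(w)`»), Thm. 18.6] [cite: SerreTate1968, §7 Thm. 10 (c), Thm. 11 and the preceding paragraph] -/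
theorem IsCMTypeRealisationOver.dual_rationalTateRep_eigenline_eventually [NumberField.IsCMField K] (Φ : CMType K)
    (A₀ : AbelianVariety k) (ι₀ : 𝓞 K →+* End A₀) (h : IsCMTypeRealisationOver Φ A₀ ι₀) :
    ∃ χ : (K →+* ℂ) → HeckeCharacter k,
      (∀ τ : K →+* ℂ, (χ τ).HasInfinityType (cmInfinityType Φ.1 τ (algebraMap k ℂ)).1
        (cmInfinityType Φ.1 τ (algebraMap k ℂ)).2) ∧
      (∀ (τ : K →+* ℂ) (x : ideleGroup k),
        ((χ (ComplexEmbedding.conjugate τ) x : ℂˣ) : ℂ) = (starRingEnd ℂ) ((χ τ x : ℂˣ) : ℂ)) ∧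
      (∀ (v : HeightOneSpectrum (𝓞 k)) (u : (v.adicCompletion k)ˣ),
        ∃ b : K, ∀ τ : K →+* ℂ, ((χ τ (localUnits v u) : ℂˣ) : ℂ) = τ b) ∧
      (∀ᶠ v : HeightOneSpectrum (𝓞 k) in Filter.cofinite,
        ∃ π : 𝓞 K,
          (∀ τ : K →+* ℂ, (χ τ).valueAtUniformizer v = τ (π : K)) ∧
          ∀ (ℓ : ℕ) [Fact ℓ.Prime], (ℓ : 𝓞 k) ∉ v.asIdeal →
            ∀ 𝔓 ∈ v.primesAbove, ∀ σ : Field.absoluteGaloisGroup k, IsArithFrobAt (𝓞 k) σ 𝔓 →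
              A₀.rationalTateRep ℓ σ = rationalTateModuleMap ℓ (ι₀ π : A₀ ⟶ A₀) ∧
              ∀ (R : Type) [Field R] [Algebra ℚ_[ℓ] R] (e : K →+* R)
                (f : R ⊗[ℚ_[ℓ]] Module.Dual ℚ_[ℓ] (A₀.rationalTateModule ℓ)),
                (∀ x : 𝓞 K, ((rationalTateModuleMap ℓ (ι₀ x : A₀ ⟶ A₀)).dualMap).baseChange R f = e (x : K) • f) →
                ((A₀.rationalTateRep ℓ).dual σ).baseChange R f = (e (π : K))⁻¹ • f) := by
  obtain ⟨χ, h1, h2, h3, h5⟩ := shimuraTaniyama_heckeCharactersST_eventually_of_thm18_6 shimura1998_thm18_6_holds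
    k K Φ A₀ ι₀ h
  refine ⟨χ, h1, h2, h3, ?_⟩
  filter_upwards [h5] with v hv
  obtain ⟨π, hπ, hfrob, -⟩ := hv
  -- `π ≠ 0`: `χ_τ(ϖ_v)` is the coercion of a unit of `ℂ`, and some `τ : K →+* ℂ` exists
  have hπ0 : (π : K) ≠ 0 := by
    obtain ⟨τ⟩ := (inferInstance : Nonempty (K →+* ℂ))
    intro h0
    have := hπ τ
    rw [h0, map_zero] at this
    exact (Units.ne_zero _) this
  refine ⟨π, hπ, fun ℓ _ hℓ 𝔓 h𝔓 σ hσ => ?_⟩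
  have hV : A₀.rationalTateRep ℓ σ = rationalTateModuleMap ℓ (ι₀ π : A₀ ⟶ A₀) :=
    rationalTateRep_eq_of_tateRep_eq (hfrob ℓ hℓ 𝔓 h𝔓 σ hσ)
  refine ⟨hV, fun R _ _ e f hf => ?_⟩
  have he : e (π : K) ≠ 0 := fun h0 => hπ0 (e.injective (by rw [h0, map_zero]))
  have hf' : ((A₀.rationalTateRep ℓ σ).dualMap).baseChange R f = e (π : K) • f := by
    rw [hV]; exact hf π
  exact Representation.dual_baseChange_eq_inv_smul_of_eigen (A₀.rationalTateRep ℓ) R σ he f hf'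

/-- **Shimura–Taniyama on the dual eigenline, along `ι′ ∘ τ` — the registered normalisation of [Liu2021] Thm. D.6 (1).**  Same as
the head with the eigencharacter `e := ι′ ∘ τ` for a ring homomorphism `ι′ : ℂ →+* R` into a field over `ℚ_ℓ` (e.g. an
isomorphism `ℂ ≃ ℚ_ℓ^{ac}`) and an embedding `τ : K →+* ℂ`: on the `(ι′ ∘ τ)`-eigenline of `R ⊗ (V_ℓ A₀)^∨` every arithmetic
Frobenius at `v` acts by `(ι′ (χ_τ(ϖ_v)))⁻¹` — «Frobenius acts on the `χ_τ`-part of `H¹_ét` by the INVERSE uniformiser value».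
[cite: Shimura1998, Thm. 19.11 (proof) with Thm. 18.6] [cite: SerreTate1968, §7 Thm. 11] [cite: Liu2021, App. D Thm. D.6 (1) and §D.4 (FJcycle.tex l. 5628)] -/
theorem IsCMTypeRealisationOver.dual_rationalTateRep_eigenline_eventually_along [NumberField.IsCMField K] (Φ : CMType K)
    (A₀ : AbelianVariety k) (ι₀ : 𝓞 K →+* End A₀) (h : IsCMTypeRealisationOver Φ A₀ ι₀) :
    ∃ χ : (K →+* ℂ) → HeckeCharacter k,
      (∀ τ : K →+* ℂ, (χ τ).HasInfinityType (cmInfinityType Φ.1 τ (algebraMap k ℂ)).1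
        (cmInfinityType Φ.1 τ (algebraMap k ℂ)).2) ∧
      (∀ᶠ v : HeightOneSpectrum (𝓞 k) in Filter.cofinite,
        ∀ (ℓ : ℕ) [Fact ℓ.Prime], (ℓ : 𝓞 k) ∉ v.asIdeal →
          ∀ 𝔓 ∈ v.primesAbove, ∀ σ : Field.absoluteGaloisGroup k, IsArithFrobAt (𝓞 k) σ 𝔓 →
            ∀ (R : Type) [Field R] [Algebra ℚ_[ℓ] R] (ι' : ℂ →+* R) (τ : K →+* ℂ)
              (f : R ⊗[ℚ_[ℓ]] Module.Dual ℚ_[ℓ] (A₀.rationalTateModule ℓ)),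
              (∀ x : 𝓞 K, ((rationalTateModuleMap ℓ (ι₀ x : A₀ ⟶ A₀)).dualMap).baseChange R f = ι' (τ (x : K)) • f) →
              ((A₀.rationalTateRep ℓ).dual σ).baseChange R f = (ι' ((χ τ).valueAtUniformizer v))⁻¹ • f) := by
  obtain ⟨χ, h1, -, -, h5⟩ := h.dual_rationalTateRep_eigenline_eventually Φ A₀ ι₀
  refine ⟨χ, h1, ?_⟩
  filter_upwards [h5] with v hv
  obtain ⟨π, hπ, hrest⟩ := hv
  intro ℓ _ hℓ 𝔓 h𝔓 σ hσ R _ _ ι' τ f hf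
  obtain ⟨-, hdual⟩ := hrest ℓ hℓ 𝔓 h𝔓 σ hσ
  have := hdual R (ι'.comp τ) f (fun x => by simpa only [RingHom.comp_apply] using hf x)
  simpa only [RingHom.comp_apply, hπ τ] using this

end Literature.NumberTheory.ComplexMultiplication

end
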